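import Literature.Geometry.Kaehler.RiemannSurfaceHodgeDecompositionH1
import HarnessLib

/-!
# Forms supported in a chart of a Riemann surface: the forms `f dz_p`, `g dz̄_p`, their chart
# representatives, smoothness, and the integral `∬_M a dz ∧ g dz̄_p = -2i·C ∬_ℂ a_{z_p} g dA`
# (Forster §9.8–9.12, §10.11–10.13)

Layer `Literature/Geometry/Kaehler`, sequel of `RiemannSurfaceOneFormsAsSmoothForms` (the forms
`a dz`, `b dz̄`, `c dz ∧ dz̄` recorded against the preferred frames `dz_x`, `z_x = chartAt ℂ x`,
their chart representatives `inChart_oneZeroForm` / `inChart_zeroOneForm`) and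
`RiemannSurfaceHodgeDecompositionH1` (the area form `Re((i/2) dz ∧ dz̄) = dx ∧ dy`, the chart signs
of the complex orientation). For a point `p` of a Riemann surface `M` and functions `f, g : ℂ → ℂ` on
the target of the preferred chart `z_p` this file provides:

* §1 `inChart_oneOneForm` — the representative of `c dz ∧ dz̄` in the chart `z_{x₀}` is
  `c · |T|² dy ∧ dȳ`, `T` the derivative of the change of coordinates (Forster 9.12/10.11: a
  `2`-form transforms with `|det|`, here `|φ′|²`);
* §2 `chartCoeff p f`, `chartCoeffBar p g` — the coefficient functions (against `dz_x`, `dz̄_x`) of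
  the forms **`f(z_p) dz_p`** and **`g(z_p) dz̄_p` extended by zero off the chart** (Forster's and
  Lee's «the form `f dz` in `U` and `0` outside `U`» for `f` compactly supported in the chart), with
  `inChart_oneZeroForm_chartCoeff : (f dz_p)^_{z_p} = f dy`, `inChart_zeroOneForm_chartCoeffBar`,
  and their smoothness for `C^∞` data compactly supported in the chart target
  (`isSmoothForm_zeroOneForm_chartCoeffBar`, `isSmoothForm_oneZeroForm_chartCoeff`);
* §3 **`integral_re_oneZeroForm_wedge_zeroOneForm_chartCoeffBar`** /
  **`integral_im_oneZeroForm_wedge_zeroOneForm_chartCoeffBar`** — for a smooth `a dz` and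
  `g ∈ C^∞_c` supported in the chart target, the integral over `M` (the tree's `MForm.integral` for the complex
  orientation `Complex.orientation`) of the real and imaginary parts of `a dz ∧ g dz̄_p` is
  `C · ∬_ℂ Im(a_{z_p} g) dA`, resp. `-C · ∬_ℂ Re(a_{z_p} g) dA`, i.e.
  `∬_M a dz ∧ g dz̄_p = -2i · (C/2) ∬_ℂ a_{z_p}(y) g(y) dA(y)` (Forster 10.12/10.13: the integral
  of a `2`-form supported in a chart is the plane integral of its coefficient, `dz ∧ dz̄ = -2i dx ∧ dy`),
  where `C = chartIntegralConst > 0` is a universal constant (`2 |dx∧dy(e₁,e₂)| κ`, `κ` the ratio of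
  the Haar measure of the tree's reference basis `modelBasis ℂ 2` to Lebesgue measure — the tree's
  integral is normalised on that basis, not on `(1, i)`).

Everything is proved; no named facts, no instances.

## References

* O. Forster, *Lectures on Riemann Surfaces*, GTM 81, Springer (1981), §9.8–9.12 (forms in charts,
  `dz ∧ dz̄ = -2i dx ∧ dy`), §10.11–10.13 (integration of `2`-forms supported in a chart).
  [Forster1981]
* J. M. Lee, *Introduction to Smooth Manifolds*, 2nd ed. (2013), Prop. 16.5 / Thm. 17.30 (forms
  `f dx¹ ∧ ⋯ ∧ dxⁿ` in `U` and `0` outside). [LeeSmoothManifolds2013]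
-/

noncomputable section

open scoped Manifold ContDiff Topology ComplexConjugate
open Set Filter Function Complex MeasureTheory
open Literature.NumberTheory.Transcendental

namespace Literature.Geometry.Kaehler

namespace RiemannSurface

variable {M : Type*} [TopologicalSpace M] [ChartedSpace ℂ M]

/-! ### §1 The chart representative of `c dz ∧ dz̄` -/

section Charts

/-- The derivative of a change of holomorphic coordinates `z_x ∘ z_{x₀}⁻¹` at a point of the target
of `z_{x₀}` (with `x = z_{x₀}⁻¹ y`) is nonzero. [cite: Miranda1995, Chapter IV Definition 1.2] -/
theorem deriv_chartAt_comp_symm_ne_zero [IsManifold 𝓘(ℂ, ℂ) ω M] {x₀ : M} {y : ℂ}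
    (hy : y ∈ (chartAt ℂ x₀).target) :
    deriv (chartAt ℂ ((chartAt ℂ x₀).symm y) ∘ (chartAt ℂ x₀).symm) y ≠ 0 :=
  deriv_coordChange_ne_zero (mdifferentiableOn_atlas (I := 𝓘(ℂ, ℂ)) (chart_mem_atlas ℂ _))
    (mdifferentiableOn_atlas_symm (I := 𝓘(ℂ, ℂ)) (chart_mem_atlas ℂ _))
    (mdifferentiableOn_atlas (I := 𝓘(ℂ, ℂ)) (chart_mem_atlas ℂ x₀))
    (mdifferentiableOn_atlas_symm (I := 𝓘(ℂ, ℂ)) (chart_mem_atlas ℂ x₀)) hy (mem_chart_source ℂ _)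

variable [IsManifold 𝓘(ℂ, ℂ) ω M] [IsManifold 𝓘(ℝ, ℂ) ∞ M]

/-- **The chart representative of `c dz ∧ dz̄`**: in the preferred chart at `x₀`, at `y` in the
target (with `x = z_{x₀}⁻¹ y` and `T = (z_x ∘ z_{x₀}⁻¹)′(y)`),
`(c dz ∧ dz̄)^_{z_{x₀}}(y) = c(x) |T|² dy ∧ dȳ` (a `(1,1)`-form transforms with `|T|² = T T̄`).
[cite: Forster1981, §9.12] -/
theorem inChart_oneOneForm (c : M → ℂ) {x₀ : M} {y : ℂ} (hy : y ∈ (chartAt ℂ x₀).target) :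
    (oneOneForm c).inChart x₀ y =
      (c ((chartAt ℂ x₀).symm y) *
        (deriv (chartAt ℂ ((chartAt ℂ x₀).symm y) ∘ (chartAt ℂ x₀).symm) y *
          conj (deriv (chartAt ℂ ((chartAt ℂ x₀).symm y) ∘ (chartAt ℂ x₀).symm) y))) •
        dzdzbarForm := by
  have hy' : y ∈ (extChartAt 𝓘(ℝ, ℂ) x₀).target := by simpa using hy
  rw [MForm.inChart_eq_of_mem_target _ hy']
  have hz : (extChartAt 𝓘(ℝ, ℂ) x₀).symm y = (chartAt ℂ x₀).symm y := by simp
  have h₀ : (chartAt ℂ x₀).symm y ∈ (chartAt ℂ x₀).source := (chartAt ℂ x₀).map_target hy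
  rw [hz]
  ext v
  rw [ContinuousAlternatingMap.compContinuousLinearMap_apply]
  simp only [oneOneForm_apply, ContinuousAlternatingMap.smul_apply, dzdzbarForm_apply, smul_eq_mul,
    Function.comp_apply]
  have key0 := tangentCoordChange_self_apply_eq_deriv_mul h₀ (v 0)
  have key1 := tangentCoordChange_self_apply_eq_deriv_mul h₀ (v 1)
  rw [(chartAt ℂ x₀).right_inv hy] at key0 key1
  set T := deriv (chartAt ℂ ((chartAt ℂ x₀).symm y) ∘ (chartAt ℂ x₀).symm) y with hT
  calc _ = c ((chartAt ℂ x₀).symm y) * ((T * v 0) * conj (T * v 1) - (T * v 1) * conj (T * v 0)) :=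
        congrArg₂ (fun s t : ℂ ↦ c ((chartAt ℂ x₀).symm y) * (s * conj t - t * conj s)) key0 key1
    _ = _ := by
        simp only [map_mul]
        ring

/-- The representative of `a dz ∧ b dz̄` in the chart `z_{x₀}` is
`a_{z_{x₀}}(y) · conj((conj b)_{z_{x₀}}(y)) dy ∧ dȳ` (product of the local expressions of the two
factors, `inChart_oneZeroForm`, `inChart_zeroOneForm`). [cite: Forster1981, §9.12] -/
theorem inChart_oneZeroForm_wedge_zeroOneForm (a b : M → ℂ) {x₀ : M} {y : ℂ}
    (hy : y ∈ (chartAt ℂ x₀).target) :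
    ((oneZeroForm a).wedge (zeroOneForm b)).inChart x₀ y =
      (localExpr a (chartAt ℂ x₀) y * conj (localExpr (star b) (chartAt ℂ x₀) y)) •
        dzdzbarForm := by
  rw [oneZeroForm_wedge_zeroOneForm, inChart_oneOneForm _ hy, localExpr_apply, localExpr_apply]
  congr 1
  simp only [Pi.mul_apply, Pi.star_apply, RCLike.star_def, map_mul, conj_conj]
  ring

end Charts

/-! ### §2 The forms `f(z_p) dz_p` and `g(z_p) dz̄_p` extended by zero off the chart -/

section ChartForms

open Classical in
/-- **Coefficient of the form `f(z_p) dz_p`, extended by zero off the chart at `p`**: against the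
frame `dz_x` its value at `x ∈ source(z_p)` is `f(z_p x) / (z_x ∘ z_p⁻¹)′(z_p x)` (since
`dz_p = (z_p ∘ z_x⁻¹)′ dz_x = dz_x / (z_x ∘ z_p⁻¹)′`), and `0` off the source.
[cite: Forster1981, §9.8] -/
def chartCoeff (p : M) (f : ℂ → ℂ) : M → ℂ := fun x ↦
  if x ∈ (chartAt ℂ p).source then
    f (chartAt ℂ p x) * (deriv (chartAt ℂ x ∘ (chartAt ℂ p).symm) (chartAt ℂ p x))⁻¹ else 0

open Classical in
/-- **Coefficient of the form `g(z_p) dz̄_p`, extended by zero off the chart at `p`**: against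
`dz̄_x` its value at `x ∈ source(z_p)` is `g(z_p x) / conj((z_x ∘ z_p⁻¹)′(z_p x))`, and `0` off the
source. [cite: Forster1981, §9.8] -/
def chartCoeffBar (p : M) (g : ℂ → ℂ) : M → ℂ := fun x ↦
  if x ∈ (chartAt ℂ p).source then
    g (chartAt ℂ p x) * (conj (deriv (chartAt ℂ x ∘ (chartAt ℂ p).symm) (chartAt ℂ p x)))⁻¹ else 0

/-- `chartCoeff p f` vanishes off the chart source. [cite: Forster1981, §9.8] -/
theorem chartCoeff_of_notMem {p x : M} (f : ℂ → ℂ) (hx : x ∉ (chartAt ℂ p).source) :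
    chartCoeff p f x = 0 := by
  simp [chartCoeff, hx]

/-- `chartCoeffBar p g` vanishes off the chart source. [cite: Forster1981, §9.8] -/
theorem chartCoeffBar_of_notMem {p x : M} (g : ℂ → ℂ) (hx : x ∉ (chartAt ℂ p).source) :
    chartCoeffBar p g x = 0 := by
  simp [chartCoeffBar, hx]

/-- `chartCoeff p f` on the chart source. [cite: Forster1981, §9.8] -/
theorem chartCoeff_of_mem {p x : M} (f : ℂ → ℂ) (hx : x ∈ (chartAt ℂ p).source) :
    chartCoeff p f x =
      f (chartAt ℂ p x) * (deriv (chartAt ℂ x ∘ (chartAt ℂ p).symm) (chartAt ℂ p x))⁻¹ := by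
  simp [chartCoeff, hx]

/-- `chartCoeffBar p g` on the chart source. [cite: Forster1981, §9.8] -/
theorem chartCoeffBar_of_mem {p x : M} (g : ℂ → ℂ) (hx : x ∈ (chartAt ℂ p).source) :
    chartCoeffBar p g x =
      g (chartAt ℂ p x) * (conj (deriv (chartAt ℂ x ∘ (chartAt ℂ p).symm) (chartAt ℂ p x)))⁻¹ := by
  simp [chartCoeffBar, hx]

/-- `chartCoeffBar p g x = 0` where `g (z_p x) = 0`. [cite: Forster1981, §9.8] -/
theorem chartCoeffBar_eq_zero_of_apply_eq_zero {p x : M} {g : ℂ → ℂ} (hg : g (chartAt ℂ p x) = 0) :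
    chartCoeffBar p g x = 0 := by
  by_cases hx : x ∈ (chartAt ℂ p).source
  · rw [chartCoeffBar_of_mem g hx, hg, zero_mul]
  · exact chartCoeffBar_of_notMem g hx

/-- `chartCoeff p f x = 0` where `f (z_p x) = 0`. [cite: Forster1981, §9.8] -/
theorem chartCoeff_eq_zero_of_apply_eq_zero {p x : M} {f : ℂ → ℂ} (hf : f (chartAt ℂ p x) = 0) :
    chartCoeff p f x = 0 := by
  by_cases hx : x ∈ (chartAt ℂ p).source
  · rw [chartCoeff_of_mem f hx, hf, zero_mul]
  · exact chartCoeff_of_notMem f hx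

/-- `chartCoeffBar` is additive in `g`. [cite: Forster1981, §9.8] -/
theorem chartCoeffBar_add (p : M) (g g' : ℂ → ℂ) :
    chartCoeffBar p (g + g') = chartCoeffBar p g + chartCoeffBar p g' := by
  funext x
  by_cases hx : x ∈ (chartAt ℂ p).source
  · simp only [Pi.add_apply, chartCoeffBar_of_mem _ hx]
    ring
  · simp only [Pi.add_apply, chartCoeffBar_of_notMem _ hx, add_zero]

/-- `chartCoeffBar` is homogeneous in `g`. [cite: Forster1981, §9.8] -/
theorem chartCoeffBar_smul (p : M) (c : ℂ) (g : ℂ → ℂ) :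
    chartCoeffBar p (c • g) = c • chartCoeffBar p g := by
  funext x
  by_cases hx : x ∈ (chartAt ℂ p).source
  · simp only [Pi.smul_apply, smul_eq_mul, chartCoeffBar_of_mem _ hx]
    ring
  · simp only [Pi.smul_apply, smul_eq_mul, chartCoeffBar_of_notMem _ hx, mul_zero]

variable [IsManifold 𝓘(ℂ, ℂ) ω M]

/-- **The local expression of `f(z_p) dz_p` in the chart `z_p` is `f`** (on the chart target).
[cite: Forster1981, §9.8] -/
theorem localExpr_chartCoeff {p : M} (f : ℂ → ℂ) {y : ℂ} (hy : y ∈ (chartAt ℂ p).target) :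
    localExpr (chartCoeff p f) (chartAt ℂ p) y = f y := by
  have hx : (chartAt ℂ p).symm y ∈ (chartAt ℂ p).source := (chartAt ℂ p).map_target hy
  rw [localExpr_apply, chartCoeff_of_mem f hx, (chartAt ℂ p).right_inv hy, mul_assoc,
    inv_mul_cancel₀ (deriv_chartAt_comp_symm_ne_zero hy), mul_one]

/-- **The local expression of `conj` of the coefficient of `g(z_p) dz̄_p` is `conj g`** (so that the
chart representative of `g(z_p) dz̄_p` is `g dȳ`, `inChart_zeroOneForm_chartCoeffBar`).
[cite: Forster1981, §9.8] -/
theorem localExpr_star_chartCoeffBar {p : M} (g : ℂ → ℂ) {y : ℂ} (hy : y ∈ (chartAt ℂ p).target) :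
    localExpr (star (chartCoeffBar p g)) (chartAt ℂ p) y = conj (g y) := by
  have hx : (chartAt ℂ p).symm y ∈ (chartAt ℂ p).source := (chartAt ℂ p).map_target hy
  have hT := deriv_chartAt_comp_symm_ne_zero hy
  rw [localExpr_apply, Pi.star_apply, chartCoeffBar_of_mem g hx, (chartAt ℂ p).right_inv hy,
    RCLike.star_def, map_mul, map_inv₀, conj_conj, mul_assoc, inv_mul_cancel₀ hT, mul_one]

variable [IsManifold 𝓘(ℝ, ℂ) ∞ M]

/-- **`(f dz_p)^_{z_p} = f dy`**: the representative of `f(z_p) dz_p` in the chart `z_p`.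
[cite: Forster1981, §9.8] -/
theorem inChart_oneZeroForm_chartCoeff {p : M} (f : ℂ → ℂ) {y : ℂ} (hy : y ∈ (chartAt ℂ p).target) :
    (oneZeroForm (chartCoeff p f)).inChart p y = f y • dzForm := by
  rw [inChart_oneZeroForm _ hy, localExpr_chartCoeff f hy]

/-- **`(g dz̄_p)^_{z_p} = g dȳ`**: the representative of `g(z_p) dz̄_p` in the chart `z_p`.
[cite: Forster1981, §9.8] -/
theorem inChart_zeroOneForm_chartCoeffBar {p : M} (g : ℂ → ℂ) {y : ℂ}
    (hy : y ∈ (chartAt ℂ p).target) :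
    (zeroOneForm (chartCoeffBar p g)).inChart p y = g y • dzbarForm := by
  rw [inChart_zeroOneForm _ hy, localExpr_star_chartCoeffBar g hy, conj_conj]

/-- **`(a dz ∧ g dz̄_p)^_{z_p} = a_{z_p} g dy ∧ dȳ`** on the chart target.
[cite: Forster1981, §9.12] -/
theorem inChart_oneZeroForm_wedge_zeroOneForm_chartCoeffBar (a : M → ℂ) {p : M} (g : ℂ → ℂ) {y : ℂ}
    (hy : y ∈ (chartAt ℂ p).target) :
    ((oneZeroForm a).wedge (zeroOneForm (chartCoeffBar p g))).inChart p y =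
      (localExpr a (chartAt ℂ p) y * g y) • dzdzbarForm := by
  rw [inChart_oneZeroForm_wedge_zeroOneForm _ _ hy, localExpr_star_chartCoeffBar g hy, conj_conj]

omit [IsManifold 𝓘(ℂ, ℂ) ω M] [IsManifold 𝓘(ℝ, ℂ) ∞ M] in
/-- The set of points of the chart source mapped into a compact subset `K` of the chart target is
closed in `M` (it is the compact set `z_p⁻¹(K)`), i.e. its complement is open. [folklore] -/
private theorem isOpen_compl_source_inter_preimage [T2Space M] (p : M) {K : Set ℂ}
    (hK : IsCompact K) (hKt : K ⊆ (chartAt ℂ p).target) :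
    IsOpen ((chartAt ℂ p).source ∩ chartAt ℂ p ⁻¹' K)ᶜ := by
  have hc : IsCompact ((chartAt ℂ p).source ∩ chartAt ℂ p ⁻¹' K) := by
    have heq : (chartAt ℂ p).source ∩ chartAt ℂ p ⁻¹' K = (chartAt ℂ p).symm '' K := by
      ext x
      constructor
      · rintro ⟨hx, hxK⟩
        exact ⟨chartAt ℂ p x, hxK, (chartAt ℂ p).left_inv hx⟩
      · rintro ⟨y, hyK, rfl⟩
        exact ⟨(chartAt ℂ p).map_target (hKt hyK),
          by rw [mem_preimage, (chartAt ℂ p).right_inv (hKt hyK)]; exact hyK⟩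
    rw [heq]
    exact hK.image_of_continuousOn ((chartAt ℂ p).continuousOn_symm.mono hKt)
  exact hc.isClosed.isOpen_compl

/-- **`g(z_p) dz̄_p` is a smooth form** when `g ∈ C^∞(ℂ)` has compact support inside the chart
target (smooth on the source by its representative `g dȳ`, zero near every point off the compact
`z_p⁻¹(supp g)`). [cite: Forster1981, §9.8] -/
theorem isSmoothForm_zeroOneForm_chartCoeffBar [T2Space M] {p : M} {g : ℂ → ℂ}
    (hg : ContDiff ℝ ∞ g) (hgc : HasCompactSupport g) (hgt : tsupport g ⊆ (chartAt ℂ p).target) :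
    IsSmoothForm (zeroOneForm (chartCoeffBar p g)) := by
  rw [isSmoothForm_iff_smoothAt]
  intro z
  by_cases hz : z ∈ (chartAt ℂ p).source
  · have hz' : z ∈ (extChartAt 𝓘(ℝ, ℂ) p).source := by simpa using hz
    refine MForm.smoothAt_of_contDiffWithinAt_inChart hz' ?_
    rw [ModelWithCorners.Boundaryless.range_eq_univ, contDiffWithinAt_univ]
    have hpz : extChartAt 𝓘(ℝ, ℂ) p z = chartAt ℂ p z := by simp
    rw [hpz]
    have hev : (zeroOneForm (chartCoeffBar p g)).inChart p =ᶠ[𝓝 (chartAt ℂ p z)]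
        fun y ↦ g y • dzbarForm := by
      filter_upwards [(chartAt ℂ p).open_target.mem_nhds ((chartAt ℂ p).map_source hz)] with y hy
      exact inChart_zeroOneForm_chartCoeffBar g hy
    exact (hg.contDiffAt.smul contDiffAt_const).congr_of_eventuallyEq hev
  · have hO := isOpen_compl_source_inter_preimage p hgc hgt
    have hzO : z ∈ ((chartAt ℂ p).source ∩ chartAt ℂ p ⁻¹' tsupport g)ᶜ := fun h ↦ hz h.1
    have hev : ∀ᶠ x in 𝓝 z, (0 : MForm 𝓘(ℝ, ℂ) M ℂ 1) x = zeroOneForm (chartCoeffBar p g) x := by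
      filter_upwards [hO.mem_nhds hzO] with x hx
      have h0 : chartCoeffBar p g x = 0 := by
        by_cases hxs : x ∈ (chartAt ℂ p).source
        · have hxK : chartAt ℂ p x ∉ tsupport g := fun h ↦ hx ⟨hxs, h⟩
          exact chartCoeffBar_eq_zero_of_apply_eq_zero (image_eq_zero_of_notMem_tsupport hxK)
        · exact chartCoeffBar_of_notMem g hxs
      have h1 : zeroOneForm (chartCoeffBar p g) x = zeroOneForm (0 : M → ℂ) x :=
        congrArg (fun c : ℂ ↦ (c • dzbarForm : ℂ [⋀^Fin 1]→L[ℝ] ℂ)) h0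
      rw [h1, zeroOneForm_zero]
    exact (MForm.smoothAt_zero z).congr_of_eventuallyEq hev

/-- **`f(z_p) dz_p` is a smooth form** when `f ∈ C^∞(ℂ)` has compact support inside the chart
target. [cite: Forster1981, §9.8] -/
theorem isSmoothForm_oneZeroForm_chartCoeff [T2Space M] {p : M} {f : ℂ → ℂ}
    (hf : ContDiff ℝ ∞ f) (hfc : HasCompactSupport f) (hft : tsupport f ⊆ (chartAt ℂ p).target) :
    IsSmoothForm (oneZeroForm (chartCoeff p f)) := by
  rw [isSmoothForm_iff_smoothAt]
  intro z
  by_cases hz : z ∈ (chartAt ℂ p).source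
  · have hz' : z ∈ (extChartAt 𝓘(ℝ, ℂ) p).source := by simpa using hz
    refine MForm.smoothAt_of_contDiffWithinAt_inChart hz' ?_
    rw [ModelWithCorners.Boundaryless.range_eq_univ, contDiffWithinAt_univ]
    have hpz : extChartAt 𝓘(ℝ, ℂ) p z = chartAt ℂ p z := by simp
    rw [hpz]
    have hev : (oneZeroForm (chartCoeff p f)).inChart p =ᶠ[𝓝 (chartAt ℂ p z)]
        fun y ↦ f y • dzForm := by
      filter_upwards [(chartAt ℂ p).open_target.mem_nhds ((chartAt ℂ p).map_source hz)] with y hy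
      exact inChart_oneZeroForm_chartCoeff f hy
    exact (hf.contDiffAt.smul contDiffAt_const).congr_of_eventuallyEq hev
  · have hO := isOpen_compl_source_inter_preimage p hfc hft
    have hzO : z ∈ ((chartAt ℂ p).source ∩ chartAt ℂ p ⁻¹' tsupport f)ᶜ := fun h ↦ hz h.1
    have hev : ∀ᶠ x in 𝓝 z, (0 : MForm 𝓘(ℝ, ℂ) M ℂ 1) x = oneZeroForm (chartCoeff p f) x := by
      filter_upwards [hO.mem_nhds hzO] with x hx
      have h0 : chartCoeff p f x = 0 := by
        by_cases hxs : x ∈ (chartAt ℂ p).source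
        · have hxK : chartAt ℂ p x ∉ tsupport f := fun h ↦ hx ⟨hxs, h⟩
          exact chartCoeff_eq_zero_of_apply_eq_zero (image_eq_zero_of_notMem_tsupport hxK)
        · exact chartCoeff_of_notMem f hxs
      have h1 : oneZeroForm (chartCoeff p f) x = oneZeroForm (0 : M → ℂ) x :=
        congrArg (fun c : ℂ ↦ (c • dzForm : ℂ [⋀^Fin 1]→L[ℝ] ℂ)) h0
      rw [h1, oneZeroForm_zero]
    exact (MForm.smoothAt_zero z).congr_of_eventuallyEq hev

end ChartForms

/-! ### §3 Integrals of `2`-forms supported in a chart -/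

section Integral

omit [ChartedSpace ℂ M] in
/-- **`dz ∧ dz̄ = -2i dx ∧ dy`**, pointwise: `dzdzbarForm v = -2i · areaForm v`
(`areaForm = Re((i/2) dz ∧ dz̄)`). [cite: Forster1981, §9.12] -/
theorem dzdzbarForm_eq_neg_two_mul_I_mul_areaForm (v : Fin 2 → ℂ) :
    dzdzbarForm v = -2 * I * (areaForm v : ℂ) := by
  rw [areaForm_apply, dzdzbarForm_apply]
  set z : ℂ := v 0 * conj (v 1) with hz
  have hconj : v 1 * conj (v 0) = conj z := by rw [hz, map_mul, conj_conj, mul_comm]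
  rw [hconj, Complex.sub_conj]
  apply Complex.ext
  · simp
  · simp

variable [Fact (Module.finrank ℝ ℂ = 2)]

/-- **The Haar normalisation constant** `κ`: the Haar measure of the tree's reference basis
`modelBasis ℂ 2` of `ℂ` (against which `MForm.integral` is computed in charts) is `κ ·` Lebesgue
measure (uniqueness of Haar measure). [cite: LeeSmoothManifolds2013, Prop. 16.5] -/
def haarFactor : NNReal := Measure.addHaarScalarFactor (modelBasis ℂ 2).addHaar volume

/-- `(modelBasis ℂ 2).addHaar = κ · volume`. [cite: LeeSmoothManifolds2013, Prop. 16.5] -/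
theorem addHaar_modelBasis_eq_smul_volume :
    (modelBasis ℂ 2).addHaar = haarFactor • (volume : Measure ℂ) :=
  Measure.isAddLeftInvariant_eq_smul _ _

/-- `κ > 0`. [cite: LeeSmoothManifolds2013, Prop. 16.5] -/
theorem haarFactor_pos : 0 < haarFactor :=
  Measure.addHaarScalarFactor_pos_of_isAddHaarMeasure _ _

/-- Integrals against the Haar measure of the reference basis are `κ ·` Lebesgue integrals.
[cite: LeeSmoothManifolds2013, Prop. 16.5] -/
theorem integral_addHaar_modelBasis (F : ℂ → ℝ) :
    ∫ y, F y ∂(modelBasis ℂ 2).addHaar = (haarFactor : ℝ) * ∫ y, F y := by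
  rw [addHaar_modelBasis_eq_smul_volume, integral_smul_nnreal_measure, NNReal.smul_def, smul_eq_mul]

/-- **The normalisation constant `C` of chart integrals** on a Riemann surface:
`C = 2 |dx∧dy(e₁, e₂)| κ` for the reference basis `e = modelBasis ℂ 2`, so that
`∬_M Re(c dz ∧ dz̄) = C ∬_ℂ Im(c) dA` for `c dz ∧ dz̄` supported in a chart
(`integral_re_oneZeroForm_wedge_zeroOneForm_chartCoeffBar`). [cite: Forster1981, §10.12] -/
def chartIntegralConst : ℝ := 2 * |areaForm (modelBasis ℂ 2)| * (haarFactor : ℝ)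

/-- The area form does not vanish on the reference basis. [cite: Forster1981, §9.12] -/
theorem areaForm_modelBasis_ne_zero : areaForm (modelBasis ℂ 2) ≠ 0 :=
  Literature.AlgebraicGeometry.HodgeTheory.apply_basis_ne_zero_of_ne_zero (modelBasis ℂ 2)
    areaForm_toAlternatingMap_ne_zero

/-- `C > 0`. [cite: Forster1981, §10.12] -/
theorem chartIntegralConst_pos : 0 < chartIntegralConst :=
  mul_pos (mul_pos two_pos (abs_pos.2 areaForm_modelBasis_ne_zero))
    (NNReal.coe_pos.2 haarFactor_pos)

/-- The chart signs of the complex orientation are the constant `sign (dx∧dy(e₁,e₂))` on every chart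
target. [cite: LeeSmoothManifolds2013, Prop. 15.6] -/
theorem chartSign_complexOrientation_eq [IsManifold 𝓘(ℂ, ℂ) ω M] (p : M) {y : ℂ}
    (hy : y ∈ (chartAt ℂ p).target) :
    chartSign (I := 𝓘(ℝ, ℂ)) (M := M) (fun _ ↦ Complex.orientation) p y =
      Real.sign (areaForm (modelBasis ℂ 2)) := by
  haveI := isManifold_real_of_isManifold_complex (E := ℂ) (M := M)
  obtain ⟨r, hr, hrψ⟩ := exists_someVector_complexOrientation_eq
  have hsv : Real.sign (Complex.orientation.someVector (modelBasis ℂ 2)) =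
      Real.sign (areaForm (modelBasis ℂ 2)) := by
    rw [hrψ, AlternatingMap.smul_apply, ContinuousAlternatingMap.coe_toAlternatingMap, smul_eq_mul,
      real_sign_mul, Real.sign_of_pos hr, one_mul]
  have hx : (chartAt ℂ p).symm y ∈ (extChartAt 𝓘(ℝ, ℂ) p).source := by
    simpa using (chartAt ℂ p).map_target hy
  have h := Literature.AlgebraicGeometry.HodgeTheory.chartSign_const_extChartAt
    (M := M) Complex.orientation hx
  have hy' : extChartAt 𝓘(ℝ, ℂ) p ((chartAt ℂ p).symm y) = y := by
    simp [(chartAt ℂ p).right_inv hy]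
  rw [hy'] at h
  rw [h, hsv]

variable [IsManifold 𝓘(ℂ, ℂ) ω M] [IsManifold 𝓘(ℝ, ℂ) ∞ M] [CompactSpace M] [T2Space M]

omit [Fact (Module.finrank ℝ ℂ = 2)] [IsManifold 𝓘(ℂ, ℂ) ω M] [IsManifold 𝓘(ℝ, ℂ) ∞ M]
  [CompactSpace M] [T2Space M] in
/-- The form `a dz ∧ g dz̄_p` vanishes where `g ∘ z_p` does (and off the chart source); hence it is
supported in `z_p⁻¹(supp g)`. [cite: Forster1981, §10.12] -/
theorem oneZeroForm_wedge_zeroOneForm_chartCoeffBar_apply_eq_zero {p : M} (a : M → ℂ) {g : ℂ → ℂ}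
    {x : M} (hx : chartCoeffBar p g x = 0) :
    ((oneZeroForm a).wedge (zeroOneForm (chartCoeffBar p g))) x = 0 := by
  rw [oneZeroForm_wedge_zeroOneForm]
  have h1 : oneOneForm (a * chartCoeffBar p g) x = oneOneForm (0 : M → ℂ) x :=
    congrArg (fun c : ℂ ↦ (c • dzdzbarForm : ℂ [⋀^Fin 2]→L[ℝ] ℂ))
      (show (a * chartCoeffBar p g) x = (0 : M → ℂ) x by simp [hx])
  rw [h1, oneOneForm_zero]
  rfl

/-- **The integral of `Re(a dz ∧ g dz̄_p)` over `M` is `C ∬_ℂ Im(a_{z_p} g) dA`** for a smooth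
`a dz` and `g ∈ C^∞_c(ℂ)` supported in the target of the chart `z_p` (the integral of a `2`-form
supported in a chart is the plane integral of its chart density; here the density of
`a dz ∧ g dz̄_p` is `a_{z_p} g · dy ∧ dȳ = -2i a_{z_p} g dA`). [cite: Forster1981, §10.12] -/
theorem integral_re_oneZeroForm_wedge_zeroOneForm_chartCoeffBar (p : M) {a : M → ℂ}
    (ha : IsSmoothForm (oneZeroForm a)) {g : ℂ → ℂ} (hg : ContDiff ℝ ∞ g)
    (hgc : HasCompactSupport g) (hgt : tsupport g ⊆ (chartAt ℂ p).target) :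
    MForm.integral (fun _ : M ↦ Complex.orientation)
        ((oneZeroForm a).wedge (zeroOneForm (chartCoeffBar p g))).re =
      chartIntegralConst * ∫ y, (localExpr a (chartAt ℂ p) y * g y).im := by
  classical
  set β : MForm 𝓘(ℝ, ℂ) M ℂ 2 := (oneZeroForm a).wedge (zeroOneForm (chartCoeffBar p g)) with hβ
  set mb := modelBasis ℂ 2 with hmb
  have hσ : IsSmoothForm (zeroOneForm (chartCoeffBar p g)) :=
    isSmoothForm_zeroOneForm_chartCoeffBar hg hgc hgt
  have hβs : IsSmoothForm β := IsSmoothFormWedge_holds 𝓘(ℝ, ℂ) M ℂ ha hσ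
  have hA0 : areaForm mb ≠ 0 := areaForm_modelBasis_ne_zero
  -- a top form normalised on the reference basis
  set D : ℂ [⋀^Fin 2]→L[ℝ] ℝ := (areaForm mb)⁻¹ • areaForm with hD_def
  have hD : D mb = 1 := by
    rw [hD_def, ContinuousAlternatingMap.smul_apply, smul_eq_mul, inv_mul_cancel₀ hA0]
  -- support of `Re β`
  have hKt : tsupport g ⊆ (extChartAt 𝓘(ℝ, ℂ) p).target := by simpa using hgt
  have hK : ∀ x, β.re x ≠ 0 →
      x ∈ (extChartAt 𝓘(ℝ, ℂ) p).source ∧ extChartAt 𝓘(ℝ, ℂ) p x ∈ tsupport g := by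
    intro x hx
    have hc : chartCoeffBar p g x ≠ 0 := by
      intro h0
      apply hx
      have hβ0 : β x = 0 := oneZeroForm_wedge_zeroOneForm_chartCoeffBar_apply_eq_zero a h0
      change Complex.reCLM.compContinuousAlternatingMap (β x) = 0
      rw [hβ0]
      rfl
    have hxs : x ∈ (chartAt ℂ p).source := by
      by_contra h
      exact hc (chartCoeffBar_of_notMem g h)
    have hgx : g (chartAt ℂ p x) ≠ 0 := fun h ↦ hc (chartCoeffBar_eq_zero_of_apply_eq_zero h)
    refine ⟨by simpa using hxs, ?_⟩
    have hpx : extChartAt 𝓘(ℝ, ℂ) p x = chartAt ℂ p x := by simp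
    rw [hpx]
    exact subset_tsupport g hgx
  have hε : ∀ y ∈ tsupport g, chartSign (I := 𝓘(ℝ, ℂ)) (M := M)
      (fun _ ↦ Complex.orientation) p y = Real.sign (areaForm mb) := fun y hy ↦
    chartSign_complexOrientation_eq p (hgt hy)
  rw [MForm.integral_eq_chartDensity (fun _ : M ↦ Complex.orientation) p hD hβs.re hgc hKt hK hε]
  -- the chart density of `Re β`
  have hdens : MForm.chartDensity p β.re =
      fun y ↦ 2 * areaForm mb * (localExpr a (chartAt ℂ p) y * g y).im := by
    funext y
    by_cases hy : y ∈ (extChartAt 𝓘(ℝ, ℂ) p).target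
    · have hy' : y ∈ (chartAt ℂ p).target := by simpa using hy
      simp only [MForm.chartDensity, hy, if_true]
      rw [MForm.inChart_re]
      simp only [ContinuousLinearMap.compContinuousAlternatingMap_coe, Function.comp_apply,
        Complex.reCLM_apply]
      rw [hβ, inChart_oneZeroForm_wedge_zeroOneForm_chartCoeffBar a g hy',
        ContinuousAlternatingMap.smul_apply, dzdzbarForm_eq_neg_two_mul_I_mul_areaForm, smul_eq_mul]
      simp only [Complex.mul_re, Complex.mul_im, Complex.neg_re, Complex.neg_im, Complex.I_re,
        Complex.I_im, Complex.ofReal_re, Complex.ofReal_im, Complex.re_ofNat, Complex.im_ofNat]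
      ring
    · simp only [MForm.chartDensity, hy, if_false]
      have hgy : g y = 0 := image_eq_zero_of_notMem_tsupport (fun h ↦ hy (hKt h))
      simp [hgy]
  rw [hdens, integral_const_mul, integral_addHaar_modelBasis, chartIntegralConst,
    ← real_sign_mul_self (areaForm mb)]
  ring

/-- **The integral of `Im(a dz ∧ g dz̄_p)` over `M` is `-C ∬_ℂ Re(a_{z_p} g) dA`** (companion of
`integral_re_oneZeroForm_wedge_zeroOneForm_chartCoeffBar`; together:
`∬_M a dz ∧ g dz̄_p = -i C ∬_ℂ a_{z_p} g dA`, i.e. `dz ∧ dz̄ = -2i dA` up to the normalisation `C/2`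
of the tree's integral). [cite: Forster1981, §10.12] -/
theorem integral_im_oneZeroForm_wedge_zeroOneForm_chartCoeffBar (p : M) {a : M → ℂ}
    (ha : IsSmoothForm (oneZeroForm a)) {g : ℂ → ℂ} (hg : ContDiff ℝ ∞ g)
    (hgc : HasCompactSupport g) (hgt : tsupport g ⊆ (chartAt ℂ p).target) :
    MForm.integral (fun _ : M ↦ Complex.orientation)
        ((oneZeroForm a).wedge (zeroOneForm (chartCoeffBar p g))).im =
      -chartIntegralConst * ∫ y, (localExpr a (chartAt ℂ p) y * g y).re := by
  classical
  set β : MForm 𝓘(ℝ, ℂ) M ℂ 2 := (oneZeroForm a).wedge (zeroOneForm (chartCoeffBar p g)) with hβ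
  set mb := modelBasis ℂ 2 with hmb
  have hσ : IsSmoothForm (zeroOneForm (chartCoeffBar p g)) :=
    isSmoothForm_zeroOneForm_chartCoeffBar hg hgc hgt
  have hβs : IsSmoothForm β := IsSmoothFormWedge_holds 𝓘(ℝ, ℂ) M ℂ ha hσ
  have hA0 : areaForm mb ≠ 0 := areaForm_modelBasis_ne_zero
  set D : ℂ [⋀^Fin 2]→L[ℝ] ℝ := (areaForm mb)⁻¹ • areaForm with hD_def
  have hD : D mb = 1 := by
    rw [hD_def, ContinuousAlternatingMap.smul_apply, smul_eq_mul, inv_mul_cancel₀ hA0]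
  have hKt : tsupport g ⊆ (extChartAt 𝓘(ℝ, ℂ) p).target := by simpa using hgt
  have hK : ∀ x, β.im x ≠ 0 →
      x ∈ (extChartAt 𝓘(ℝ, ℂ) p).source ∧ extChartAt 𝓘(ℝ, ℂ) p x ∈ tsupport g := by
    intro x hx
    have hc : chartCoeffBar p g x ≠ 0 := by
      intro h0
      apply hx
      have hβ0 : β x = 0 := oneZeroForm_wedge_zeroOneForm_chartCoeffBar_apply_eq_zero a h0
      change Complex.imCLM.compContinuousAlternatingMap (β x) = 0
      rw [hβ0]
      rfl
    have hxs : x ∈ (chartAt ℂ p).source := by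
      by_contra h
      exact hc (chartCoeffBar_of_notMem g h)
    have hgx : g (chartAt ℂ p x) ≠ 0 := fun h ↦ hc (chartCoeffBar_eq_zero_of_apply_eq_zero h)
    refine ⟨by simpa using hxs, ?_⟩
    have hpx : extChartAt 𝓘(ℝ, ℂ) p x = chartAt ℂ p x := by simp
    rw [hpx]
    exact subset_tsupport g hgx
  have hε : ∀ y ∈ tsupport g, chartSign (I := 𝓘(ℝ, ℂ)) (M := M)
      (fun _ ↦ Complex.orientation) p y = Real.sign (areaForm mb) := fun y hy ↦
    chartSign_complexOrientation_eq p (hgt hy)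
  rw [MForm.integral_eq_chartDensity (fun _ : M ↦ Complex.orientation) p hD hβs.im hgc hKt hK hε]
  have hdens : MForm.chartDensity p β.im =
      fun y ↦ -(2 * areaForm mb) * (localExpr a (chartAt ℂ p) y * g y).re := by
    funext y
    by_cases hy : y ∈ (extChartAt 𝓘(ℝ, ℂ) p).target
    · have hy' : y ∈ (chartAt ℂ p).target := by simpa using hy
      simp only [MForm.chartDensity, hy, if_true]
      rw [MForm.inChart_im]
      simp only [ContinuousLinearMap.compContinuousAlternatingMap_coe, Function.comp_apply,
        Complex.imCLM_apply]
      rw [hβ, inChart_oneZeroForm_wedge_zeroOneForm_chartCoeffBar a g hy',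
        ContinuousAlternatingMap.smul_apply, dzdzbarForm_eq_neg_two_mul_I_mul_areaForm, smul_eq_mul]
      simp only [Complex.mul_re, Complex.mul_im, Complex.neg_re, Complex.neg_im, Complex.I_re,
        Complex.I_im, Complex.ofReal_re, Complex.ofReal_im, Complex.re_ofNat, Complex.im_ofNat]
      ring
    · simp only [MForm.chartDensity, hy, if_false]
      have hgy : g y = 0 := image_eq_zero_of_notMem_tsupport (fun h ↦ hy (hKt h))
      simp [hgy]
  rw [hdens, integral_const_mul, integral_addHaar_modelBasis, chartIntegralConst,
    ← real_sign_mul_self (areaForm mb)]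
  ring

/-- **`∬_M a dz ∧ g dz̄_p` as one complex number**: with `∫_M` the pair (real part, imaginary part)
of the tree's real integrals, `∬_M a dz ∧ g dz̄_p = -i C ∬_ℂ a_{z_p}(y) g(y) dA(y)` whenever
`y ↦ a_{z_p}(y) g(y)` is integrable. [cite: Forster1981, §10.12] -/
theorem integral_oneZeroForm_wedge_zeroOneForm_chartCoeffBar (p : M) {a : M → ℂ}
    (ha : IsSmoothForm (oneZeroForm a)) {g : ℂ → ℂ} (hg : ContDiff ℝ ∞ g)
    (hgc : HasCompactSupport g) (hgt : tsupport g ⊆ (chartAt ℂ p).target)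
    (hint : Integrable fun y ↦ localExpr a (chartAt ℂ p) y * g y) :
    ((MForm.integral (fun _ : M ↦ Complex.orientation)
        ((oneZeroForm a).wedge (zeroOneForm (chartCoeffBar p g))).re : ℝ) : ℂ) +
      (MForm.integral (fun _ : M ↦ Complex.orientation)
        ((oneZeroForm a).wedge (zeroOneForm (chartCoeffBar p g))).im : ℝ) * I =
      -I * chartIntegralConst * ∫ y, localExpr a (chartAt ℂ p) y * g y := by
  rw [integral_re_oneZeroForm_wedge_zeroOneForm_chartCoeffBar p ha hg hgc hgt,
    integral_im_oneZeroForm_wedge_zeroOneForm_chartCoeffBar p ha hg hgc hgt]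
  have hre : ∫ y, (localExpr a (chartAt ℂ p) y * g y).re =
      (∫ y, localExpr a (chartAt ℂ p) y * g y).re := integral_re hint
  have him : ∫ y, (localExpr a (chartAt ℂ p) y * g y).im =
      (∫ y, localExpr a (chartAt ℂ p) y * g y).im := integral_im hint
  rw [hre, him]
  set J := ∫ y, localExpr a (chartAt ℂ p) y * g y
  apply Complex.ext
  · simp
  · simp

end Integral

end RiemannSurface

end Literature.Geometry.Kaehler

end
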